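import Literature.AnabelianGeometry.SemiGraphs.OrbitGraph

/-!
# Orbits of a covering: points with the same orbit differ by a group element (proofs)

Proof-only complement to `OrbitGraph.lean` ([SemiAnbd] §3 p. 37, the underlying semi-graph of a
covering): the vertex- (edge-) orbits `OVertex`/`OEdge` are quotients by the relations
`VRel`/`ERel` ("`x' = g · x`"); this file checks that these relations generate exactly the orbit
equivalence: two points of the same fibre have the same orbit iff they differ by an element of
`Π_v` (`Π_e`) — `CovObj.exists_ρ_of_mk_eq_mk`, `CovObj.exists_ρE_of_mk_eq_mk`.
-/

namespace Literature.AnabelianGeometry.SemiGraphs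

namespace ProfiniteSemiGraph

universe u

variable {𝒢 : ProfiniteSemiGraph.{u}} (S : CovObj 𝒢)

/-- The orbit relation generated by `VRel`, in "same fibre and differ by a group element" form, is
an equivalence relation containing `VRel`; hence `EqvGen VRel` implies it. [cite: MochizukiSemiAnbd2006, Def 3.5(i) p.37] -/
private theorem eqvGen_VRel_imp {p q : Σ v : 𝒢.graph.Vertex, (S.SV v).obj.V}
    (h : Relation.EqvGen S.VRel p q) :
    ∃ (e : p.1 = q.1) (g : 𝒢.Gv q.1), (S.SV q.1).obj.ρ g (e ▸ p.2) = q.2 := by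
  induction h with
  | rel a b hab =>
    obtain ⟨v, g, x⟩ := hab
    exact ⟨rfl, g, rfl⟩
  | refl a =>
    refine ⟨rfl, 1, ?_⟩
    rw [map_one]
    rfl
  | symm a b _ ih =>
    obtain ⟨e, g, hg⟩ := ih
    obtain ⟨va, xa⟩ := a
    obtain ⟨vb, xb⟩ := b
    cases e
    refine ⟨rfl, g⁻¹, ?_⟩
    change (S.SV va).obj.ρ g xa = xb at hg
    change (S.SV va).obj.ρ g⁻¹ xb = xa
    rw [← hg]
    exact Action.ρ_inv_self_apply g xa
  | trans a b c _ _ ih₁ ih₂ =>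
    obtain ⟨e₁, g₁, hg₁⟩ := ih₁
    obtain ⟨e₂, g₂, hg₂⟩ := ih₂
    obtain ⟨va, xa⟩ := a
    obtain ⟨vb, xb⟩ := b
    obtain ⟨vc, xc⟩ := c
    cases e₁
    cases e₂
    refine ⟨rfl, g₂ * g₁, ?_⟩
    change (S.SV va).obj.ρ g₁ xa = xb at hg₁
    change (S.SV va).obj.ρ g₂ xb = xc at hg₂
    change (S.SV va).obj.ρ (g₂ * g₁) xa = xc
    rw [map_mul, ← hg₂, ← hg₁]
    rfl

/-- **Two points of `S_v` with the same `Π_v`-orbit differ by an element of `Π_v`.**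
[cite: MochizukiSemiAnbd2006, Def 3.5(i) p.37] -/
theorem CovObj.exists_ρ_of_mk_eq_mk {v : 𝒢.graph.Vertex} {x x' : (S.SV v).obj.V}
    (h : (Quot.mk S.VRel ⟨v, x⟩ : S.OVertex) = Quot.mk S.VRel ⟨v, x'⟩) :
    ∃ g : 𝒢.Gv v, (S.SV v).obj.ρ g x = x' := by
  obtain ⟨e, g, hg⟩ := eqvGen_VRel_imp S (Quot.eqvGen_exact h)
  exact ⟨g, hg⟩

/-- Edge version of `eqvGen_VRel_imp`. [cite: MochizukiSemiAnbd2006, Def 3.5(i) p.37] -/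
private theorem eqvGen_ERel_imp {p q : Σ e : 𝒢.graph.Edge, (S.SE e).obj.V}
    (h : Relation.EqvGen S.ERel p q) :
    ∃ (e : p.1 = q.1) (g : 𝒢.Ge q.1), (S.SE q.1).obj.ρ g (e ▸ p.2) = q.2 := by
  induction h with
  | rel a b hab =>
    obtain ⟨e, g, y⟩ := hab
    exact ⟨rfl, g, rfl⟩
  | refl a =>
    refine ⟨rfl, 1, ?_⟩
    rw [map_one]
    rfl
  | symm a b _ ih =>
    obtain ⟨e, g, hg⟩ := ih
    obtain ⟨ea, ya⟩ := a
    obtain ⟨eb, yb⟩ := b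
    cases e
    refine ⟨rfl, g⁻¹, ?_⟩
    change (S.SE ea).obj.ρ g ya = yb at hg
    change (S.SE ea).obj.ρ g⁻¹ yb = ya
    rw [← hg]
    exact Action.ρ_inv_self_apply g ya
  | trans a b c _ _ ih₁ ih₂ =>
    obtain ⟨e₁, g₁, hg₁⟩ := ih₁
    obtain ⟨e₂, g₂, hg₂⟩ := ih₂
    obtain ⟨ea, ya⟩ := a
    obtain ⟨eb, yb⟩ := b
    obtain ⟨ec, yc⟩ := c
    cases e₁
    cases e₂
    refine ⟨rfl, g₂ * g₁, ?_⟩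
    change (S.SE ea).obj.ρ g₁ ya = yb at hg₁
    change (S.SE ea).obj.ρ g₂ yb = yc at hg₂
    change (S.SE ea).obj.ρ (g₂ * g₁) ya = yc
    rw [map_mul, ← hg₂, ← hg₁]
    rfl

/-- **Two points of `S_e` with the same `Π_e`-orbit differ by an element of `Π_e`.**
[cite: MochizukiSemiAnbd2006, Def 3.5(i) p.37] -/
theorem CovObj.exists_ρE_of_mk_eq_mk {e : 𝒢.graph.Edge} {y y' : (S.SE e).obj.V}
    (h : (Quot.mk S.ERel ⟨e, y⟩ : S.OEdge) = Quot.mk S.ERel ⟨e, y'⟩) :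
    ∃ g : 𝒢.Ge e, (S.SE e).obj.ρ g y = y' := by
  obtain ⟨e', g, hg⟩ := eqvGen_ERel_imp S (Quot.eqvGen_exact h)
  exact ⟨g, hg⟩

/-- Representatives: every vertex-orbit over `v` is the orbit of a point of `S_v`.
[cite: MochizukiSemiAnbd2006, Def 3.5(i) p.37] -/
theorem CovObj.OVertex.exists_rep (V : S.OVertex) :
    ∃ x : (S.SV (CovObj.OVertex.base S V)).obj.V, Quot.mk S.VRel ⟨_, x⟩ = V := by
  induction V using Quot.ind with
  | mk p => exact ⟨p.2, rfl⟩

/-- Representatives for edge-orbits. [cite: MochizukiSemiAnbd2006, Def 3.5(i) p.37] -/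
theorem CovObj.OEdge.exists_rep (E : S.OEdge) :
    ∃ y : (S.SE (CovObj.OEdge.base S E)).obj.V, Quot.mk S.ERel ⟨_, y⟩ = E := by
  induction E using Quot.ind with
  | mk p => exact ⟨p.2, rfl⟩

end ProfiniteSemiGraph

end Literature.AnabelianGeometry.SemiGraphs
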